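import Summits.BirchSwinnertonDyer.BirchSwinnertonDyer.Theorems.ResidualThetaTransportAtTwoSignedMuSeedAtTwoPlusKroneckerBits
import HarnessLib

/-!
# Kronecker bits IV — the honest (non-integral `E`) form of the level-`0` Kronecker law: exact error term, uniformizer form over a
# subring, and the reduction statement in `O ⧸ P` with integrality of `Λ_e` DERIVED rather than assumed
# (seed crux `SignedMuSeedAtTwoPlus` stmt-BirchSwinnertonDyer-21438; parent Kμ⁺ stmt-BirchSwinnertonDyer-20689, route ResidualThetaTransportAtTwo;
# line card `Cruxes/SignedMuSeedAtTwoPlus/Lines/kronecker-bits.md`, T0 steps (ii)–(iv) and KB3)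

Cell `bsd-wall`, width seat `bsd-wall-rtt-p4-w2` g16 (`--supports`, closes nothing).  THEOREMS ONLY; BSD is not proved by this.

The typed stub KB2 (`levelZeroKroneckerLaw`, file `…KroneckerBits.lean`) takes `E : G → R` with `P` an ideal of `R`, i.e. it silently places the
values `E₁(z_c; L)` in the ring on which reduction is defined.  The card's actual argument (T0 (ii)–(iv)) is finer: only the smoothed values `G_α(P_c)`
are known to be `𝔓`-integral, the identity `Σ_R ε̄ G_α = (αε(α) − Nα)·Λ_e` holds in the FIELD, and integrality of `Λ_e` is DEDUCED from one `α` whose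
factor is a `𝔓`-unit.  This file types that chain for a subring `O` of a commutative ring `K` (informally `𝒪_{𝔓} ⊂ ℚ̄`), `E Gα : G → K`:

* **`halfFunctional_sub_eq`** — exact error term in `K`: `Σ_{Rset} χ⁻¹ Gα − (a χ(α)κ(α)⁻¹ − N)·Λ_e = −Σ_{Rset} χ(c)⁻¹ (κ(c) − 1) Gα(c)`;
* `halfFunctional_mem_subring` — `Σ_{Rset} χ⁻¹ Gα ∈ O` from `Gα(c) ∈ O`, `χ(c)⁻¹ ∈ O` termwise;
* **`halfFunctional_sub_eq_pi_mul`** — if moreover `κ(c) − 1 ∈ π·O` for all `c` (informally `κ ≡ 1 (mod 𝔓)`, `π` a uniformizer) then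
  `Σ_{Rset} χ⁻¹ Gα − (a χ(α)κ(α)⁻¹ − N)·Λ_e = π·y` with `y ∈ O` — no integrality of `E` or of `Λ_e` is used;
* **`red_halfFunctional_eq_of_subring`** — with `s := a χ(α)κ(α)⁻¹ − N ∈ O` a unit OF `O`: `Λ_e ∈ O` (derived from the error term) and, for
  every ideal `P` of `O` containing `π`,
  `red ⟨Σ_{Rset} χ⁻¹ Gα⟩ = red ⟨s⟩ · red ⟨Λ_e⟩` in `O ⧸ P` — T0 with integrality as a CONCLUSION
  (the unit cancellation is that of `mem_subring_of_isUnit_mul_mem` in `…KroneckerBitsMirror.lean`, inlined to keep this file on the older import).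

[folklore]
-/

set_option autoImplicit false
-- the Theorems namespace of this sub repeats the summit name by design (D-0017 nested layout)
set_option linter.dupNamespace false

open Finset

namespace Summit.BirchSwinnertonDyer.BirchSwinnertonDyer.Theorems.SignedMuAtTwo.KroneckerBits

section Integral

variable {G K : Type*} [CommGroup G] [DecidableEq G] [CommRing K] {m : G} {Rset : Finset G}

/-- **Exact error term of the level-`0` law** (in the ambient ring, no ideal): for `E` odd, `χ` even, `κ` odd, `Gα = a•E(α·) − N•E`,
`Σ_{Rset} χ(c)⁻¹ Gα(c) − (a χ(α) κ(α)⁻¹ − N) · Σ_{Rset} χ(c)⁻¹ κ(c) E(c) = −Σ_{Rset} χ(c)⁻¹ (κ(c) − 1) Gα(c)`. [folklore] -/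
theorem halfFunctional_sub_eq (E Gα : G → K) (χ κ : G →* Kˣ) (α : G) (a N : K) (hm : m * m = 1)
    (hE : ∀ c, E (m * c) = -E c) (hχ : χ m = 1) (hκ : κ m = -1) (hG : ∀ c, Gα c = a * E (α * c) - N * E c)
    (hR : ∀ c, (c ∈ Rset ∧ m * c ∉ Rset) ∨ (c ∉ Rset ∧ m * c ∈ Rset)) :
    (∑ c ∈ Rset, (((χ c)⁻¹ : Kˣ) : K) * Gα c)
        - (a * (χ α : K) * (((κ α)⁻¹ : Kˣ) : K) - N) * ∑ c ∈ Rset, (((χ c)⁻¹ : Kˣ) : K) * (κ c : K) * E c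
      = -∑ c ∈ Rset, (((χ c)⁻¹ : Kˣ) : K) * ((κ c : K) - 1) * Gα c := by
  rw [← halfResolvent_chi_kappa E Gα χ κ α a N Rset hm hE hχ hκ hG hR, ← sum_sub_distrib, ← sum_neg_distrib]
  exact sum_congr rfl fun c _ => by ring

omit [DecidableEq G] in
/-- The half-orbit functional is integral as soon as its terms are: `Gα(c) ∈ O` and `χ(c)⁻¹ ∈ O` for `c ∈ Rset`. [folklore] -/
theorem halfFunctional_mem_subring (O : Subring K) (Gα : G → K) (χ : G →* Kˣ)
    (hGO : ∀ c ∈ Rset, Gα c ∈ O) (hχO : ∀ c ∈ Rset, (((χ c)⁻¹ : Kˣ) : K) ∈ O) :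
    (∑ c ∈ Rset, (((χ c)⁻¹ : Kˣ) : K) * Gα c) ∈ O :=
  O.sum_mem fun c hc => O.mul_mem (hχO c hc) (hGO c hc)

/-- **Uniformizer form of the level-`0` law** (T0 (iii)–(iv) honestly: no integrality of `E` or `Λ_e` is assumed).  If `Gα(c) ∈ O`,
`χ(c)⁻¹ ∈ O` and `κ(c) − 1 ∈ π·O` termwise, then
`Σ_{Rset} χ⁻¹ Gα − (a χ(α)κ(α)⁻¹ − N)·Λ_e = π · y` for some `y ∈ O`. [folklore] -/
theorem halfFunctional_sub_eq_pi_mul (O : Subring K) (E Gα : G → K) (χ κ : G →* Kˣ) (α : G) (a N π : K)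
    (hm : m * m = 1) (hE : ∀ c, E (m * c) = -E c) (hχ : χ m = 1) (hκ : κ m = -1)
    (hG : ∀ c, Gα c = a * E (α * c) - N * E c)
    (hR : ∀ c, (c ∈ Rset ∧ m * c ∉ Rset) ∨ (c ∉ Rset ∧ m * c ∈ Rset))
    (hGO : ∀ c ∈ Rset, Gα c ∈ O) (hχO : ∀ c ∈ Rset, (((χ c)⁻¹ : Kˣ) : K) ∈ O)
    (hκπ : ∀ c ∈ Rset, ∃ d ∈ O, (κ c : K) - 1 = π * d) :
    ∃ y ∈ O, (∑ c ∈ Rset, (((χ c)⁻¹ : Kˣ) : K) * Gα c)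
        - (a * (χ α : K) * (((κ α)⁻¹ : Kˣ) : K) - N) * ∑ c ∈ Rset, (((χ c)⁻¹ : Kˣ) : K) * (κ c : K) * E c
      = π * y := by
  classical
  -- choose the quotients `d c` with `κ c - 1 = π * d c` on `Rset` (and `0` off `Rset`)
  have hch : ∀ c, ∃ d : K, c ∈ Rset → d ∈ O ∧ (κ c : K) - 1 = π * d := by
    intro c
    by_cases hc : c ∈ Rset
    · obtain ⟨d, hdO, hd⟩ := hκπ c hc
      exact ⟨d, fun _ => ⟨hdO, hd⟩⟩
    · exact ⟨0, fun h => absurd h hc⟩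
  choose d hd using hch
  refine ⟨-∑ c ∈ Rset, (((χ c)⁻¹ : Kˣ) : K) * d c * Gα c, ?_, ?_⟩
  · exact O.neg_mem (O.sum_mem fun c hc => O.mul_mem (O.mul_mem (hχO c hc) (hd c hc).1) (hGO c hc))
  · rw [halfFunctional_sub_eq E Gα χ κ α a N hm hE hχ hκ hG hR, mul_neg, mul_sum]
    congr 1
    exact sum_congr rfl fun c hc => by rw [(hd c hc).2]; ring

/-- **T0 with integrality as a conclusion.**  Under the hypotheses of `halfFunctional_sub_eq_pi_mul`, if the smoothing factor
`s = a χ(α)κ(α)⁻¹ − N` lies in `O` and is a unit OF `O` (informally `1 + η_e(α) ≢ 0`), then (1) `Λ_e ∈ O`, and (2) for every ideal `P` of `O`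
containing `π`: `red ⟨Σ_{Rset} χ⁻¹ Gα⟩ = red ⟨s⟩ · red ⟨Λ_e⟩` in `O ⧸ P`. [folklore] -/
theorem red_halfFunctional_eq_of_subring (O : Subring K) (P : Ideal O) (E Gα : G → K) (χ κ : G →* Kˣ) (α : G)
    (a N π : K) (hπO : π ∈ O) (hπP : (⟨π, hπO⟩ : O) ∈ P)
    (hm : m * m = 1) (hE : ∀ c, E (m * c) = -E c) (hχ : χ m = 1) (hκ : κ m = -1)
    (hG : ∀ c, Gα c = a * E (α * c) - N * E c)
    (hR : ∀ c, (c ∈ Rset ∧ m * c ∉ Rset) ∨ (c ∉ Rset ∧ m * c ∈ Rset))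
    (hGO : ∀ c ∈ Rset, Gα c ∈ O) (hχO : ∀ c ∈ Rset, (((χ c)⁻¹ : Kˣ) : K) ∈ O)
    (hκπ : ∀ c ∈ Rset, ∃ d ∈ O, (κ c : K) - 1 = π * d)
    (hs : a * (χ α : K) * (((κ α)⁻¹ : Kˣ) : K) - N ∈ O)
    (hu : IsUnit (⟨a * (χ α : K) * (((κ α)⁻¹ : Kˣ) : K) - N, hs⟩ : O)) :
    ∃ hΛ : (∑ c ∈ Rset, (((χ c)⁻¹ : Kˣ) : K) * (κ c : K) * E c) ∈ O,
      Ideal.Quotient.mk P ⟨∑ c ∈ Rset, (((χ c)⁻¹ : Kˣ) : K) * Gα c, halfFunctional_mem_subring O Gα χ hGO hχO⟩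
        = Ideal.Quotient.mk P ⟨a * (χ α : K) * (((κ α)⁻¹ : Kˣ) : K) - N, hs⟩
          * Ideal.Quotient.mk P ⟨∑ c ∈ Rset, (((χ c)⁻¹ : Kˣ) : K) * (κ c : K) * E c, hΛ⟩ := by
  obtain ⟨y, hyO, hy⟩ := halfFunctional_sub_eq_pi_mul O E Gα χ κ α a N π hm hE hχ hκ hG hR hGO hχO hκπ
  -- integrality of Λ_e: s * Λ_e = x - π * y ∈ O with s a unit of O
  have hx : (∑ c ∈ Rset, (((χ c)⁻¹ : Kˣ) : K) * Gα c) ∈ O := halfFunctional_mem_subring O Gα χ hGO hχO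
  have hsΛ : (a * (χ α : K) * (((κ α)⁻¹ : Kˣ) : K) - N)
      * ∑ c ∈ Rset, (((χ c)⁻¹ : Kˣ) : K) * (κ c : K) * E c ∈ O := by
    have h : (a * (χ α : K) * (((κ α)⁻¹ : Kˣ) : K) - N)
        * ∑ c ∈ Rset, (((χ c)⁻¹ : Kˣ) : K) * (κ c : K) * E c
          = (∑ c ∈ Rset, (((χ c)⁻¹ : Kˣ) : K) * Gα c) - π * y := by rw [← hy]; ring
    rw [h]
    exact O.sub_mem hx (O.mul_mem hπO hyO)
  -- unit cancellation inside `O` (as in `mem_subring_of_isUnit_mul_mem` of `…KroneckerBitsMirror.lean`)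
  have hΛ : (∑ c ∈ Rset, (((χ c)⁻¹ : Kˣ) : K) * (κ c : K) * E c) ∈ O := by
    obtain ⟨u, hu⟩ := hu
    have hvs : ((u⁻¹ : Oˣ) : O).val * (a * (χ α : K) * (((κ α)⁻¹ : Kˣ) : K) - N) = 1 := by
      have h1 : (((u⁻¹ : Oˣ) : O) * (u : O) : O).val = (1 : O).val := by rw [u.inv_mul]
      rwa [hu, Subring.coe_mul, Subring.coe_one] at h1
    have hrw : (∑ c ∈ Rset, (((χ c)⁻¹ : Kˣ) : K) * (κ c : K) * E c)
        = ((u⁻¹ : Oˣ) : O).val * ((a * (χ α : K) * (((κ α)⁻¹ : Kˣ) : K) - N)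
            * ∑ c ∈ Rset, (((χ c)⁻¹ : Kˣ) : K) * (κ c : K) * E c) := by
      rw [← mul_assoc, hvs, one_mul]
    rw [hrw]
    exact O.mul_mem ((u⁻¹ : Oˣ) : O).prop hsΛ
  refine ⟨hΛ, ?_⟩
  rw [← map_mul, Ideal.Quotient.eq]
  have key : (⟨∑ c ∈ Rset, (((χ c)⁻¹ : Kˣ) : K) * Gα c, hx⟩ : O)
      - ⟨a * (χ α : K) * (((κ α)⁻¹ : Kˣ) : K) - N, hs⟩ * ⟨∑ c ∈ Rset, (((χ c)⁻¹ : Kˣ) : K) * (κ c : K) * E c, hΛ⟩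
        = ⟨π, hπO⟩ * ⟨y, hyO⟩ := by
    apply Subtype.ext
    simp only [Subring.coe_mul, AddSubgroupClass.coe_sub]
    exact hy
  rw [key]
  exact P.mul_mem_right _ hπP

end Integral

end Summit.BirchSwinnertonDyer.BirchSwinnertonDyer.Theorems.SignedMuAtTwo.KroneckerBits
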